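import Summits.BirchSwinnertonDyer.Rank1Residual.X11b.BDPRouteHalves
import Summits.BirchSwinnertonDyer.Rank1Residual.X11b.TwistTransportTam
import Summits.BirchSwinnertonDyer.Rank1Residual.X11b.TwistTransportUnit
import Summits.BirchSwinnertonDyer.Rank1Residual.GaloisImage.JWitnessTowerSurjectivity
import Summits.BirchSwinnertonDyer.Rank1Residual.Additive.X4RankZeroKatoBound
import Literature.NumberTheory.EllipticCurves.MatsunoCurvesRankProofs
import HarnessLib

/-!
# Route `AdditiveBranchIMC` (rung K1), crux `GordTwoRankOne` (item 19358): the HEIGHT-FREE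
# Heegner–Kolyvagin road — Jetchev–Skinner–Wan 2017 §7.4.1 run at an ADDITIVE prime. Part 1: the twist
# transports at a prime dividing the level and the pointwise LOWER half
# (cell `bsd-addord`, second prover lane `bsd-addord-k1-c3x`, gen 0; `--supports` only)

HONEST FRAMING. THEOREMS ONLY: no definition, no new named fact, no `sorry`; nothing is booked; BSD is
not proved by any of this; the crux stays OPEN at class level. The ONE non-published input of this road
is the STEP-L-shaped predicate `X11b.IndexLowerBoundAt W p K P` of route X11b (B9, `p ∥ N`), asked here at
a prime with `p² ∣ N` (hypothesis `hL` below; NOT in print at an additive prime — presearch 2026-08-27: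
W. Zhang 2014 / Burungale–Castella–Grossi–Skinner arXiv:2312.09301 good ordinary `p`; Sweeting
arXiv:2012.11771 `p ∤ N·D_K`; Skinner–Zhang 2014 `p ∥ N`, unrefereed).

THE ROAD (lane B; lane A = cyclotomic branch road `ChiBranchLowerDivisibilityAt` + Disegni cyc-line
`p`-adic Gross–Zagier + Schneider `A′ ≠ 0`). For `E/ℚ` of analytic rank `1` and an additive potentially
good prime `p`, take an imaginary quadratic `K` in which every `ℓ ∣ N` splits (so `p` splits) with
`L(E^{d_K},1) ≠ 0`. Then `E^{d_K} ≅ E` over `ℚ_p`: the rank-`0` twist is AGAIN additive potentially good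
at `p` with the same `p`-adic image (§1), so Kato's Euler-system inequality in its Tamagawa-exact reading
(Kato 2004 Thm 14.5 (3) + Prop 14.16 (2), tree fact `Kato2004.rankZero_padicValNat_sha_add_padicValNat_…`,
no Manin datum) bounds `Ш(E^{d_K})[p^∞]` from ABOVE; x11b's class-free Gross–Zagier bookkeeping identity
(`X11b.exists_shaAn_padicVal_eq_of_heegner`, JSW (eq:gz for K′) + (eq:tamK)) gives
`ord_p #Ш(E)_an = 2·ord_p[E(K):ℤP] − ord_p q_d − ord_p ∏c_ℓ(E) − 2·ord_p #E^{d_K}(ℚ)_tors`; and STEP L_add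
closes the LOWER half: `v(q) ≤ v(Ш_E) + v(Ш_d) + v(c_E) − v(q_d) − 2v(t_d) ≤ v(Ш_E) + v(c_E) − v(c_d) ≤
v(Ш_E)`, the last step by the ALL-`p` inequality `ord_p ∏c(E) ≤ ord_p ∏c(E^{d_K})` (§1). NO Λ-adic branch
object, NO `p`-adic height / Schneider / `A′` / line datum, NO Tamagawa condition, `p = 3` allowed.
§1: transports to a model `Wd = Cd • W^{(d_K)}` at a prime `p ∣ N` (additive reduction; `ord_p u(Cd) = 0`;
`ord_p ∏c_ℓ(E) ≤ ord_p ∏c_ℓ(Wd)` for EVERY `p`). §2: the pointwise LOWER half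
`missingLowerBoundAt_rankOne_additive_of_indexLowerBoundAt`. Part 2 (`…HeegnerKolyvagin.lean`): the
per-pair McCallum-certificate supplier, the Manin-unit datum at `p ≥ 11`, the class-level theorem.

References: [JetchevSkinnerWan2017] §7.4.1; [Kato2004Asterisque] Thm 14.5 (3), Prop 14.16 (2); [GrossZagier1986]
V.§2; [KolyvaginEulerSystems1990] Thm A; [SilvermanAEC2009] VII.1, VII.5, X.5; [Miller2011LMS] Def 1.1.
-/

set_option autoImplicit false
set_option linter.dupNamespace false
noncomputable section

open scoped Classical NumberField
open WeierstrassCurve NumberField IsDedekindDomain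
  Literature.NumberTheory.EllipticCurves Literature.NumberTheory.EllipticCurves.ModularForms
  Literature.NumberTheory.EllipticCurves.Rank1Residual
  Literature.NumberTheory.EllipticCurves.Rank1Residual.Typed
  Summit.BirchSwinnertonDyer.Rank1Residual
  Summit.BirchSwinnertonDyer.Rank1Residual.Additive
  Summit.BirchSwinnertonDyer.Rank1Residual.X11b
  Summit.BirchSwinnertonDyer.Rank1Residual.GaloisImage
  Literature.NumberTheory.Automorphic

namespace Summit.BirchSwinnertonDyer.BirchSwinnertonDyer.Theorems.AdditiveBranchIMCGordTwoRankOne.HeegnerKolyvagin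

/-! ### §1 Transports to the twist by the Heegner field at a prime dividing the level -/

/-- **Twisting by a `q`-adic square does not change good reduction at `q`** (`E^{(d)} = E^{(θ²)} ≅ E`
over `ℚ_q`, `exists_variableChange_smul_eq_quadraticTwist_sq`; good reduction is read off any two
`ℚ_q`-isomorphic minimal equations, `hasGoodReduction_iff_of_isMinimal_of_eq_smul`); the multiplicative
analogue is x11b's `hasMultiplicativeReductionAtPrime_quadraticTwist_iff`.
[cite: SilvermanAEC2009, VII.5 Prop. 5.1(a), VII.1 Prop. 1.3(b) and X.5 Cor. 5.4] -/
theorem hasGoodReductionAtPrime_quadraticTwist_iff_of_isSquare (E : WeierstrassCurve ℚ) [E.IsElliptic]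
    {q : ℕ} [Fact q.Prime] {d : ℚ} (hd : d ≠ 0) (hsq : IsSquare (algebraMap ℚ ℚ_[q] d)) :
    (E.quadraticTwist d).HasGoodReductionAtPrime q ↔ E.HasGoodReductionAtPrime q := by
  -- adapted from x11b `hasMultiplicativeReductionAtPrime_quadraticTwist_iff`
  obtain ⟨θ, hθ⟩ := hsq
  have hθ0 : θ ≠ 0 := by
    rintro rfl
    exact (map_ne_zero (algebraMap ℚ ℚ_[q])).mpr hd (hθ.trans (mul_zero 0))
  haveI : (E.baseChange ℚ_[q]).IsElliptic :=
    inferInstanceAs (E.map (algebraMap ℚ ℚ_[q])).IsElliptic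
  haveI hEt : (E.quadraticTwist d).IsElliptic := E.isElliptic_quadraticTwist hd
  haveI : ((E.quadraticTwist d).baseChange ℚ_[q]).IsElliptic :=
    inferInstanceAs ((E.quadraticTwist d).map (algebraMap ℚ ℚ_[q])).IsElliptic
  obtain ⟨C, hC⟩ := (E.baseChange ℚ_[q]).exists_variableChange_smul_eq_quadraticTwist_sq hθ0
  have h1 : (E.quadraticTwist d).baseChange ℚ_[q] = C • E.baseChange ℚ_[q] := by
    rw [hC, baseChange, baseChange, map_quadraticTwist, hθ, sq]
  unfold HasGoodReductionAtPrime
  set X : WeierstrassCurve ℚ_[q] := E.baseChange ℚ_[q] with hX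
  set Y : WeierstrassCurve ℚ_[q] := (E.quadraticTwist d).baseChange ℚ_[q] with hY
  set D₁ : VariableChange ℚ_[q] := (X.exists_isMinimal ℤ_[q]).choose with hD₁
  set D₂ : VariableChange ℚ_[q] := (Y.exists_isMinimal ℤ_[q]).choose with hD₂
  have hm₁ : X.minimal ℤ_[q] = D₁ • X := rfl
  have hm₂ : Y.minimal ℤ_[q] = D₂ • Y := rfl
  have h : Y.minimal ℤ_[q] = (D₂ * C * D₁⁻¹) • X.minimal ℤ_[q] := by
    rw [hm₂, h1, hm₁, mul_smul, mul_smul, inv_smul_smul]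
  exact hasGoodReduction_iff_of_isMinimal_of_eq_smul ℤ_[q] h

/-- **Good reduction at `ℓ` is a property of the curve, not of the equation** (prime-indexed form over
`ℚ`, proved as its multiplicative sibling `hasMultiplicativeReductionAtPrime_smul_iff`: the chosen
`ℤ_ℓ`-minimal models of `W ⊗ ℚ_ℓ` and `(C • W) ⊗ ℚ_ℓ` are `ℚ_ℓ`-isomorphic minimal equations).
[cite: SilvermanAEC2009, VII.5 Prop. 5.1(a) and VII.1 Prop. 1.3(b)] -/
theorem hasGoodReductionAtPrime_smul_iff' (W : WeierstrassCurve ℚ) (C : VariableChange ℚ) (ℓ : ℕ)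
    [Fact ℓ.Prime] : (C • W).HasGoodReductionAtPrime ℓ ↔ W.HasGoodReductionAtPrime ℓ := by
  unfold HasGoodReductionAtPrime
  set X : WeierstrassCurve ℚ_[ℓ] := W.baseChange ℚ_[ℓ] with hX
  set Y : WeierstrassCurve ℚ_[ℓ] := (C • W).baseChange ℚ_[ℓ] with hY
  set D₁ : VariableChange ℚ_[ℓ] := (X.exists_isMinimal ℤ_[ℓ]).choose with hD₁
  set D₂ : VariableChange ℚ_[ℓ] := (Y.exists_isMinimal ℤ_[ℓ]).choose with hD₂
  have h₁ : X.minimal ℤ_[ℓ] = D₁ • X := rfl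
  have h₂ : Y.minimal ℤ_[ℓ] = D₂ • Y := rfl
  have hYX : Y = C.map (algebraMap ℚ ℚ_[ℓ]) • X :=
    WeierstrassCurve.VariableChange.baseChange_smul_eq W C ℚ_[ℓ]
  have h : Y.minimal ℤ_[ℓ] = (D₂ * C.map (algebraMap ℚ ℚ_[ℓ]) * D₁⁻¹) • X.minimal ℤ_[ℓ] := by
    rw [h₂, hYX, h₁, mul_smul, mul_smul, inv_smul_smul]
  exact hasGoodReduction_iff_of_isMinimal_of_eq_smul ℤ_[ℓ] h

/-- **Every model of `E^{(d_K)}` is ADDITIVE at every additive prime `p` of `E`**, for `K` satisfying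
the Heegner hypothesis for the conductor of `E`: `p ∣ N`, so `d_K ∈ ℚ_p^{×2}`
(`isSquare_discr_padic_of_heegner`) and `Wd ⊗ ℚ_p ≅ W ⊗ ℚ_p` is neither good nor multiplicative. (At an
additive `p` split in `K` the twist is the rank-`0` member of an N10-type pair AT THE SAME PRIME.)
[cite: SilvermanAEC2009, VII.5 Prop. 5.1 and X.5 Cor. 5.4] [cite: Serre1973, Ch. II §3.3 Thm 3] -/
theorem addv_twist_of_heegner (W : WeierstrassCurve ℚ) [W.IsElliptic] (p : ℕ) [Fact p.Prime]
    (K : Type) [Field K] [NumberField K] (hK : IsImaginaryQuadratic K)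
    (hH : SatisfiesHeegnerHypothesis (W.conductorNorm ℤ) K) (hadd : Addv W p)
    {Wd : WeierstrassCurve ℚ} [Wd.IsElliptic] (Cd : VariableChange ℚ)
    (hWd : Cd • W.quadraticTwist (NumberField.discr K : ℚ) = Wd) : Addv Wd p := by
  have hD0 : (NumberField.discr K : ℚ) ≠ 0 := by exact_mod_cast NumberField.discr_ne_zero K
  haveI : (W.quadraticTwist (NumberField.discr K : ℚ)).IsElliptic := W.isElliptic_quadraticTwist hD0
  have hpN : p ∣ W.conductorNorm ℤ := (W.dvd_conductorNorm_iff_not_hasGoodReductionAtPrime p).mpr hadd.1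
  have hsq := isSquare_discr_padic_of_heegner K hK hH p hpN
  refine ⟨?_, ?_⟩
  · rw [← hWd, hasGoodReductionAtPrime_smul_iff']
    exact fun h ↦ hadd.1 ((hasGoodReductionAtPrime_quadraticTwist_iff_of_isSquare W hD0 hsq).mp h)
  · rw [← hWd, hasMultiplicativeReductionAtPrime_smul_iff]
    exact fun h ↦ hadd.2 ((hasMultiplicativeReductionAtPrime_quadraticTwist_iff W hD0 hsq).mp h)

/-- **The side condition `ord_p u = 0` at ANY prime `p ∣ N` for the twist by the Heegner field** —
x11b's `padicValRat_u_eq_zero_of_twist_minimal` with "`W` multiplicative at `p`" weakened to "`W` not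
good at `p`" (its proof only uses `p ∣ N`: `d_K ∈ ℚ_p^{×2}`, `p ∤ d_K`, the two `ℤ_p`-minimal equations
are `ℚ_p`-isomorphic, so `v_p(Δ(Wd)) = v_p(Δ(W))`, and `Δ(Wd) = u⁻¹²·d_K⁶·Δ(W)`).
[cite: SilvermanAEC2009, VII.1 Prop. 1.3(b) and X.5 Cor. 5.4] -/
theorem padicValRat_u_eq_zero_of_twist_minimal' (W : WeierstrassCurve ℚ) [W.IsElliptic]
    [W.IsGloballyMinimal] (p : ℕ) [Fact p.Prime] (K : Type) [Field K] [NumberField K]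
    (hK : IsImaginaryQuadratic K) (hH : SatisfiesHeegnerHypothesis (W.conductorNorm ℤ) K)
    (hng : ¬ W.HasGoodReductionAtPrime p) {Wd : WeierstrassCurve ℚ} [Wd.IsElliptic]
    [Wd.IsGloballyMinimal] (Cd : VariableChange ℚ)
    (hWd : Cd • W.quadraticTwist (NumberField.discr K : ℚ) = Wd) :
    padicValRat p (Cd.u : ℚ) = 0 := by
  -- adapted from x11b `padicValRat_u_eq_zero_of_twist_minimal` (TwistTransportUnit.lean)
  have hp : p.Prime := Fact.out
  set d : ℚ := (NumberField.discr K : ℚ) with hd_def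
  have hD0 : d ≠ 0 := by rw [hd_def]; exact_mod_cast NumberField.discr_ne_zero K
  haveI : (W.baseChange ℚ_[p]).IsElliptic :=
    inferInstanceAs (W.map (algebraMap ℚ ℚ_[p])).IsElliptic
  haveI : (W.quadraticTwist d).IsElliptic := W.isElliptic_quadraticTwist hD0
  have hpN : p ∣ W.conductorNorm ℤ := (W.dvd_conductorNorm_iff_not_hasGoodReductionAtPrime p).mpr hng
  have hsq : IsSquare (algebraMap ℚ ℚ_[p] d) := isSquare_discr_padic_of_heegner K hK hH p hpN
  have hpd : ¬ (p : ℤ) ∣ NumberField.discr K :=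
    Literature.SatisfiesHeegnerHypothesis.not_dvd_discr hK.1 hH hp hpN
  obtain ⟨θ, hθ⟩ := hsq
  have hθ0 : θ ≠ 0 := by
    rintro rfl
    exact (map_ne_zero (algebraMap ℚ ℚ_[p])).mpr hD0 (hθ.trans (mul_zero 0))
  set X : WeierstrassCurve ℚ_[p] := W.baseChange ℚ_[p] with hX
  set Y : WeierstrassCurve ℚ_[p] := Wd.baseChange ℚ_[p] with hY
  haveI hXmin : X.IsMinimal ℤ_[p] := isMinimal_map_padic_of_isGloballyMinimal W p
  haveI hYmin : Y.IsMinimal ℤ_[p] := isMinimal_map_padic_of_isGloballyMinimal Wd p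
  obtain ⟨C, hC⟩ := (W.baseChange ℚ_[p]).exists_variableChange_smul_eq_quadraticTwist_sq hθ0
  have h1 : (W.quadraticTwist d).baseChange ℚ_[p] = C • X := by
    rw [hC, baseChange, baseChange, map_quadraticTwist, hθ, sq]
  have hYX : Y = (Cd.map (algebraMap ℚ ℚ_[p]) * C) • X := by
    rw [hY, ← hWd, WeierstrassCurve.VariableChange.baseChange_smul_eq (W.quadraticTwist d) Cd ℚ_[p],
      h1, mul_smul]
  set V := (IsDiscreteValuationRing.maximalIdeal ℤ_[p]).valuation ℚ_[p] with hV
  have hval : V Y.Δ = V X.Δ := valuation_Δ_eq_of_isMinimal_of_eq_smul ℤ_[p] hYX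
  have hΔd : Wd.Δ = (↑Cd.u⁻¹ : ℚ) ^ 12 * (d ^ 6 * W.Δ) := by
    rw [← hWd, variableChange_Δ, quadraticTwist_Δ]
  have hYΔ : Y.Δ = algebraMap ℚ ℚ_[p] Wd.Δ := by rw [hY, baseChange, map_Δ]
  have hXΔ : X.Δ = algebraMap ℚ ℚ_[p] W.Δ := by rw [hX, baseChange, map_Δ]
  rw [hYΔ, hXΔ, hΔd] at hval
  simp only [map_mul, map_pow] at hval
  have hΔ0 : V (algebraMap ℚ ℚ_[p] W.Δ) ≠ 0 :=
    (Valuation.ne_zero_iff V).mpr ((map_ne_zero _).mpr W.isUnit_Δ.ne_zero)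
  have hvd : V (algebraMap ℚ ℚ_[p] d) = 1 := by
    have : algebraMap ℚ ℚ_[p] d = ((NumberField.discr K : ℤ) : ℚ_[p]) := by
      rw [hd_def, map_intCast]
    rw [this]
    exact valuation_maximalIdeal_intCast_eq_one p hpd
  rw [hvd, one_pow, one_mul, mul_left_eq_self₀] at hval
  have hu12 : V (algebraMap ℚ ℚ_[p] (↑Cd.u⁻¹ : ℚ)) ^ 12 = 1 := hval.resolve_right hΔ0
  have hu1 : V (algebraMap ℚ ℚ_[p] (↑Cd.u⁻¹ : ℚ)) = 1 :=
    (pow_eq_one_iff_left (by norm_num)).mp hu12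
  have hu : V ((Cd.u : ℚ) : ℚ_[p]) = 1 := by
    rw [Units.val_inv_eq_inv_val, map_inv₀, map_inv₀, inv_eq_one] at hu1
    rw [← hu1, eq_ratCast]
  exact padicValRat_eq_zero_of_valuation_eq_one p (Cd.u.ne_zero) hu

/-- **`ord_p c_ℓ(E) ≤ ord_p c_ℓ(E^{d_K})` at EVERY prime `ℓ`, for EVERY prime `p`, under the Heegner
hypothesis** (the inequality half of Jetchev–Skinner–Wan's (eq:tamK), with NO `p ≥ 5`; x11b's
`padicValNat_localTamagawaNumber_twist_eq` is the equality at `p ≥ 5`): if `ℓ ∣ N` then `d_K ∈ ℚ_ℓ^{×2}`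
and `c_ℓ(Wd) = c_ℓ(W)`; if `ℓ ∤ N` then `c_ℓ(W) = 1`.
[cite: JetchevSkinnerWan2017, §7.4.1 (eq:tamK), pp. 29–31] [cite: SilvermanAEC2009, VII.6 Ex. 7.6 and X.5 Cor. 5.4] -/
theorem padicValNat_localTamagawaNumber_le_twist (W : WeierstrassCurve ℚ) [W.IsElliptic]
    (p : ℕ) [Fact p.Prime] (K : Type) [Field K] [NumberField K]
    (hK : IsImaginaryQuadratic K) (hH : SatisfiesHeegnerHypothesis (W.conductorNorm ℤ) K)
    {Wd : WeierstrassCurve ℚ} [Wd.IsElliptic] (Cd : VariableChange ℚ)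
    (hWd : Cd • W.quadraticTwist (NumberField.discr K : ℚ) = Wd) (ℓ : ℕ) [Fact ℓ.Prime] :
    padicValNat p ((W.baseChange ℚ_[ℓ]).localTamagawaNumber ℤ_[ℓ]) ≤
      padicValNat p ((Wd.baseChange ℚ_[ℓ]).localTamagawaNumber ℤ_[ℓ]) := by
  -- adapted from x11b `padicValNat_localTamagawaNumber_twist_eq` (TwistTransportTam.lean)
  set d : ℚ := (NumberField.discr K : ℚ) with hd_def
  have hD0 : d ≠ 0 := by rw [hd_def]; exact_mod_cast NumberField.discr_ne_zero K
  haveI : (W.baseChange ℚ_[ℓ]).IsElliptic :=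
    inferInstanceAs (W.map (algebraMap ℚ ℚ_[ℓ])).IsElliptic
  haveI : (Wd.baseChange ℚ_[ℓ]).IsElliptic :=
    inferInstanceAs (Wd.map (algebraMap ℚ ℚ_[ℓ])).IsElliptic
  haveI : (W.quadraticTwist d).IsElliptic := W.isElliptic_quadraticTwist hD0
  by_cases hℓN : ℓ ∣ W.conductorNorm ℤ
  · obtain ⟨θ, hθ⟩ := isSquare_discr_padic_of_heegner K hK hH ℓ hℓN
    have hθ0 : θ ≠ 0 := by
      rintro rfl
      exact (map_ne_zero (algebraMap ℚ ℚ_[ℓ])).mpr hD0 (hθ.trans (mul_zero 0))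
    obtain ⟨C, hC⟩ := (W.baseChange ℚ_[ℓ]).exists_variableChange_smul_eq_quadraticTwist_sq hθ0
    have h1 : (W.quadraticTwist d).baseChange ℚ_[ℓ] = C • W.baseChange ℚ_[ℓ] := by
      rw [hC, baseChange, baseChange, map_quadraticTwist, hθ, sq]
    have hYX : Wd.baseChange ℚ_[ℓ] = (Cd.map (algebraMap ℚ ℚ_[ℓ]) * C) • W.baseChange ℚ_[ℓ] := by
      rw [← hWd, WeierstrassCurve.VariableChange.baseChange_smul_eq (W.quadraticTwist d) Cd ℚ_[ℓ],
        h1, mul_smul]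
    rw [hYX, localTamagawaNumber_variableChange_holds ℤ_[ℓ] (W.baseChange ℚ_[ℓ])
      (Cd.map (algebraMap ℚ ℚ_[ℓ]) * C)]
  · have hgood : W.HasGoodReductionAtPrime ℓ := by
      by_contra h
      exact hℓN ((W.dvd_conductorNorm_iff_not_hasGoodReductionAtPrime ℓ).mpr h)
    have hcW : (W.baseChange ℚ_[ℓ]).localTamagawaNumber ℤ_[ℓ] = 1 := by
      haveI : ((W.baseChange ℚ_[ℓ]).minimal ℤ_[ℓ]).HasGoodReduction ℤ_[ℓ] := hgood
      exact localTamagawaNumber_eq_one_of_hasGoodReduction_holds ℤ_[ℓ] _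
    rw [hcW, padicValNat_one_right]
    exact Nat.zero_le _

/-- **Transport (d), inequality form, ALL `p`: `ord_p ∏_ℓ c_ℓ(E) ≤ ord_p ∏_ℓ c_ℓ(E^{d_K})`** under the
Heegner hypothesis, for ANY model of the twist and ANY prime `p` (`p = 3` and `2 ∣ d_K` included): finite
products over the union of the bad places, compared place by place.
[cite: JetchevSkinnerWan2017, §7.4.1 (eq:tamK), pp. 29–31] [cite: SilvermanATAEC1994, Cor. IV.9.2(d) (PDF p. 340)] -/
theorem padicValNat_tamagawaProduct_le_twist_of_heegner (W : WeierstrassCurve ℚ) [W.IsElliptic]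
    (p : ℕ) [Fact p.Prime] (K : Type) [Field K] [NumberField K]
    (hK : IsImaginaryQuadratic K) (hH : SatisfiesHeegnerHypothesis (W.conductorNorm ℤ) K)
    {Wd : WeierstrassCurve ℚ} [Wd.IsElliptic] (Cd : VariableChange ℚ)
    (hWd : Cd • W.quadraticTwist (NumberField.discr K : ℚ) = Wd) :
    padicValNat p W.tamagawaProduct ≤ padicValNat p Wd.tamagawaProduct := by
  -- adapted from x11b `padicValNat_tamagawaProduct_twist_of_heegner`
  have hfW : (W.badPlaces ℤ).Finite := W.finite_badPlaces_holds ℤ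
  have hfWd : (Wd.badPlaces ℤ).Finite := Wd.finite_badPlaces_holds ℤ
  set s : Finset (IsDedekindDomain.HeightOneSpectrum ℤ) := hfW.toFinset ∪ hfWd.toFinset with hs
  have hsW : ∀ v, ¬ W.HasGoodReductionAt v → v ∈ s := fun v hv ↦
    Finset.mem_union_left _ (by rw [Set.Finite.mem_toFinset, mem_badPlaces_iff]; exact hv)
  have hsWd : ∀ v, ¬ Wd.HasGoodReductionAt v → v ∈ s := fun v hv ↦
    Finset.mem_union_right _ (by rw [Set.Finite.mem_toFinset, mem_badPlaces_iff]; exact hv)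
  rw [tamagawaProduct_eq_prod W s hsW, tamagawaProduct_eq_prod Wd s hsWd,
    padicValNat_finset_prod p s _ fun v _ ↦ ?_, padicValNat_finset_prod p s _ fun v _ ↦ ?_]
  · refine Finset.sum_le_sum fun v _ ↦ ?_
    haveI := Fact.mk (Rat.HeightOneSpectrum.primesEquiv v).2
    exact padicValNat_localTamagawaNumber_le_twist W p K hK hH Cd hWd (Rat.HeightOneSpectrum.primesEquiv v)
  · haveI := Fact.mk (Rat.HeightOneSpectrum.primesEquiv v).2
    haveI : (Wd.baseChange ℚ_[Rat.HeightOneSpectrum.primesEquiv v]).IsElliptic :=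
      inferInstanceAs (Wd.map (algebraMap ℚ ℚ_[Rat.HeightOneSpectrum.primesEquiv v])).IsElliptic
    exact localTamagawaNumber_padic_ne_zero_holds (Rat.HeightOneSpectrum.primesEquiv v) _
  · haveI := Fact.mk (Rat.HeightOneSpectrum.primesEquiv v).2
    haveI : (W.baseChange ℚ_[Rat.HeightOneSpectrum.primesEquiv v]).IsElliptic :=
      inferInstanceAs (W.map (algebraMap ℚ ℚ_[Rat.HeightOneSpectrum.primesEquiv v])).IsElliptic
    exact localTamagawaNumber_padic_ne_zero_holds (Rat.HeightOneSpectrum.primesEquiv v) _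

/-! ### §2 The pointwise LOWER half in analytic rank `1` at an ADDITIVE potentially good prime -/

/-- **The main-conjecture half from a STEP-L-shaped input, with the Tamagawa transport as an
INEQUALITY** — x11b's class-free `missingLowerBoundAt_of_indexLowerBoundAt` (Jetchev–Skinner–Wan 2017
§7.4.1) with `ord_p ∏c_ℓ(Wd) = ord_p ∏c_ℓ(W)` weakened to `≤` (the only direction used: `v(q) = 2v(I) −
v(q_d) − v(c_W) − 2v(t_d) ≤ v(Ш_W) + v(c_W) − v(c_d) ≤ v(Ш_W)`). ANY reduction type at `p`.
[cite: JetchevSkinnerWan2017, §7.4.1 (eq:shalowerK-1)–(eq:shalower), pp. 30–31] [cite: Miller2011LMS, Def. 1.1] -/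
theorem missingLowerBoundAt_of_indexLowerBoundAt_le
    (W : WeierstrassCurve ℚ) [W.IsElliptic] [W.IsGloballyMinimal] (p : ℕ) [Fact p.Prime]
    (N : ℕ) [NeZero N] (K : Type) [Field K] [NumberField K]
    (Dt : ModularParametrizationData W N) (H : HeegnerDatum N (NumberField.discr K)) (ι : K →+* ℂ)
    (P : (W.baseChange K).toAffine.Point)
    (hGZ : gross_zagier N W K) (hKo : kolyvagin N W K)
    (hGZK : rank_eq_analyticRank_of_analyticRank_le_one) (hmod : hasEntireLFunction_rat)
    (hK : IsImaginaryQuadratic K) (hHN : SatisfiesHeegnerHypothesis N K)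
    (hP : WeierstrassCurve.Affine.Point.map ι.toRatAlgHom P = heegnerPointComplex Dt H)
    (hp2 : p ≠ 2) (hc : ¬ (p : ℤ) ∣ Dt.c) (hμ : ¬ p ∣ Units.torsionOrder K)
    (hr : W.analyticRank = 1)
    (hLt : (W.quadraticTwist (NumberField.discr K : ℚ)).entireLFunction 1 ≠ 0)
    (Wd : WeierstrassCurve ℚ) [Wd.IsElliptic] [Wd.IsGloballyMinimal] (Cd : VariableChange ℚ)
    (hWd : Cd • W.quadraticTwist (NumberField.discr K : ℚ) = Wd)
    (hu : padicValRat p (Cd.u : ℚ) = 0)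
    (htam : padicValNat p W.tamagawaProduct ≤ padicValNat p Wd.tamagawaProduct)
    (htw : ∃ q : ℚ, Wd.entireLFunction 1 / (Wd.realPeriodRat : ℂ) = (q : ℂ) ∧
      (padicValNat p Wd.shaOrder : ℤ) + padicValNat p Wd.tamagawaProduct -
        2 * padicValNat p Wd.torsionOrder ≤ padicValRat p q)
    (hL : Finite (W.baseChange K).sha → IndexLowerBoundAt W p K P) :
    Typed.MissingLowerBoundAt W p := by
  -- adapted from x11b `missingLowerBoundAt_of_indexLowerBoundAt` (BDPRouteHalves.lean)
  obtain ⟨qd, hqd, hvqd⟩ := htw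
  obtain ⟨-, hfinK, hsha, q, hq, hval⟩ := exists_shaAn_padicVal_eq_of_heegner W p N K Dt H ι P
    hGZ hKo hGZK hmod hK hHN hP hp2 hc hμ hr hLt Wd Cd hWd hu qd hqd
  have hKL := hL hfinK
  unfold IndexLowerBoundAt at hKL
  refine ⟨q, hq, ?_⟩
  have e1 : (2 * padicValNat p (AddSubgroup.zmultiples P).index : ℤ) ≤
      padicValNat p (W.baseChange K).shaOrder + 2 * padicValNat p W.tamagawaProduct := by
    exact_mod_cast hKL
  have e2 : (padicValNat p (W.baseChange K).shaOrder : ℤ) =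
      padicValNat p W.shaOrder + padicValNat p Wd.shaOrder := by exact_mod_cast hsha
  have e3 : (padicValNat p W.tamagawaProduct : ℤ) ≤ padicValNat p Wd.tamagawaProduct := by
    exact_mod_cast htam
  omega

/-- **The twist's `≤`-half at an odd ADDITIVE POTENTIALLY GOOD prime from Kato 2004 Thm. 14.5 (3) +
Prop. 14.16 (2) in the Tamagawa-exact reading** (tree fact
`Kato2004.rankZero_padicValNat_sha_add_padicValNat_tamagawa_le_of_additive_potGood_of_imageContainsSL2`,
`hKatoT`; NO Manin datum, NO Tamagawa hypothesis): for `Wd/ℚ` globally minimal with `L(Wd,1) ≠ 0`, `p`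
odd, `Wd` additive at `p` with `0 ≤ ord_p j(Wd)` and `ρ̄_{Wd,p^n}` onto for every `n` (Kato's (12.5.2) by
`Kato2004.imageContainsSL2_of_forall_hasSurjectiveModNGaloisRep`), Gross–Zagier–Kolyvagin `hGZK` for the
finiteness of `Ш(Wd)`: the shape `htw` of x11b's halves (torsion term dropped on the safe side).
[cite: Kato2004Asterisque, Thm. 14.5 (3) (p. 236), Prop. 14.16 (2) (p. 244), (12.5.2) (p. 222)] -/
theorem twist_le_half_of_katoTamagawaExact
    (hKatoT : Kato2004.rankZero_padicValNat_sha_add_padicValNat_tamagawa_le_of_additive_potGood_of_imageContainsSL2)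
    (hGZK : rank_eq_analyticRank_of_analyticRank_le_one) (hmod : hasEntireLFunction_rat)
    (Wd : WeierstrassCurve ℚ) [Wd.IsElliptic] [Wd.IsGloballyMinimal] (p : ℕ) [Fact p.Prime]
    (hp2 : p ≠ 2) (hadd : Addv Wd p) (hj : 0 ≤ padicValRat p Wd.j)
    (hsurj : ∀ n : ℕ, Wd.HasSurjectiveModNGaloisRep (p ^ n : ℕ))
    (hL : Wd.entireLFunction 1 ≠ 0) :
    ∃ q : ℚ, Wd.entireLFunction 1 / (Wd.realPeriodRat : ℂ) = (q : ℂ) ∧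
      (padicValNat p Wd.shaOrder : ℤ) + padicValNat p Wd.tamagawaProduct -
        2 * padicValNat p Wd.torsionOrder ≤ padicValRat p q := by
  have hrd : Wd.analyticRank = 0 := (Wd.analyticRank_eq_zero_iff_holds (hmod Wd)).2 hL
  haveI hfin : Finite Wd.sha := (hGZK Wd (by rw [hrd]; exact zero_le_one)).2
  obtain ⟨q, hq, hle⟩ := hKatoT Wd p hp2 hadd.1 hadd.2 hj
    (Kato2004.imageContainsSL2_of_forall_hasSurjectiveModNGaloisRep Wd p hsurj) hL hfin
  refine ⟨q, hq, ?_⟩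
  have hsha : padicValNat p (Nat.card (AddCommGroup.primaryComponent Wd.sha p)) =
      padicValNat p Wd.shaOrder := by
    unfold WeierstrassCurve.shaOrder
    exact padicValNat_card_addPrimaryComponent p
  rw [← hsha]
  have h0 : (0 : ℤ) ≤ 2 * padicValNat p Wd.torsionOrder := by positivity
  linarith

/-- **THE POINTWISE LOWER HALF at an additive potentially good prime, from STEP L_add** (Jetchev–Skinner–Wan
2017 §7.4.1 run at `p² ∣ N`). Data: `W/ℚ` globally minimal of conductor `N`, `ord_{s=1} L(E,s) = 1`, `p` odd,
`E` additive at `p` with `0 ≤ ord_p j(E)` and `ρ̄_{E,p^n}` onto for every `n`; `K` imaginary quadratic with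
the Heegner hypothesis for `N` (so `p` splits), `p ∤ #𝓞_K^×`, `L(E^{d_K},1) ≠ 0`; `P ∈ E(K)` the Heegner
point of a datum `Dt` with `p ∤ c(Dt)`; `Wd = Cd • W^{(d_K)}` a globally minimal model of the twist.
PUBLISHED binders: `hGZ`, `hKo` (qualitative), `hKatoT` (Kato 14.5 (3) Tamagawa-exact, applied to the
TWIST — additive potentially good at `p` with the same image, §1), `hGZK`, `hmod`. CONCLUSION: STEP L at `P`
⇒ `Typed.MissingLowerBoundAt W p`. No Λ-adic input / height / Schneider / `A′` / line datum / Tamagawa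
condition; `p = 3` allowed. [cite: JetchevSkinnerWan2017, §7.4.1 (pp. 29–31)]
[cite: Kato2004Asterisque, Thm. 14.5 (3) (p. 236)] [cite: Miller2011LMS, Def. 1.1] -/
theorem missingLowerBoundAt_rankOne_additive_of_indexLowerBoundAt
    (W : WeierstrassCurve ℚ) [W.IsElliptic] [W.IsGloballyMinimal] (p : ℕ) [Fact p.Prime]
    [NeZero (W.conductorNorm ℤ)] (K : Type) [Field K] [NumberField K]
    (Dt : ModularParametrizationData W (W.conductorNorm ℤ))
    (H : HeegnerDatum (W.conductorNorm ℤ) (NumberField.discr K)) (ι : K →+* ℂ)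
    (P : (W.baseChange K).toAffine.Point)
    -- the published inputs (named facts of the tree)
    (hGZ : gross_zagier (W.conductorNorm ℤ) W K) (hKo : kolyvagin (W.conductorNorm ℤ) W K)
    (hKatoT : Kato2004.rankZero_padicValNat_sha_add_padicValNat_tamagawa_le_of_additive_potGood_of_imageContainsSL2)
    (hGZK : rank_eq_analyticRank_of_analyticRank_le_one) (hmod : hasEntireLFunction_rat)
    -- the pair
    (hr : W.analyticRank = 1) (hp2 : p ≠ 2) (hadd : Addv W p) (hj : 0 ≤ padicValRat p W.j)
    (hsurj : ∀ n : ℕ, W.HasSurjectiveModNGaloisRep (p ^ n : ℕ))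
    -- the Heegner data
    (hK : IsImaginaryQuadratic K) (hHN : SatisfiesHeegnerHypothesis (W.conductorNorm ℤ) K)
    (hP : WeierstrassCurve.Affine.Point.map ι.toRatAlgHom P = heegnerPointComplex Dt H)
    (hc : ¬ (p : ℤ) ∣ Dt.c) (hμ : ¬ p ∣ Units.torsionOrder K)
    (hLt : (W.quadraticTwist (NumberField.discr K : ℚ)).entireLFunction 1 ≠ 0)
    (Wd : WeierstrassCurve ℚ) [Wd.IsElliptic] [Wd.IsGloballyMinimal] (Cd : VariableChange ℚ)
    (hWd : Cd • W.quadraticTwist (NumberField.discr K : ℚ) = Wd)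
    -- STEP L_add
    (hL : Finite (W.baseChange K).sha → IndexLowerBoundAt W p K P) :
    Typed.MissingLowerBoundAt W p := by
  have hD0 : (NumberField.discr K : ℚ) ≠ 0 := by exact_mod_cast NumberField.discr_ne_zero K
  haveI hEt : (W.quadraticTwist (NumberField.discr K : ℚ)).IsElliptic := W.isElliptic_quadraticTwist hD0
  -- transports to the minimal twist model at the additive prime `p ∣ N`
  have haddd : Addv Wd p := addv_twist_of_heegner W p K hK hHN hadd Cd hWd
  have hjd : 0 ≤ padicValRat p Wd.j := by
    have hjeq : Wd.j = W.j := by subst hWd; rw [variableChange_j, W.j_quadraticTwist hD0]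
    rw [hjeq]; exact hj
  have hsurjd : ∀ n : ℕ, Wd.HasSurjectiveModNGaloisRep (p ^ n : ℕ) := fun n ↦
    (hasSurjectiveModNGaloisRep_pow_iff_of_model_twist W p hD0 ⟨Cd, hWd⟩ n).mpr (hsurj n)
  have htam : padicValNat p W.tamagawaProduct ≤ padicValNat p Wd.tamagawaProduct :=
    padicValNat_tamagawaProduct_le_twist_of_heegner W p K hK hHN Cd hWd
  have hu : padicValRat p (Cd.u : ℚ) = 0 :=
    padicValRat_u_eq_zero_of_twist_minimal' W p K hK hHN hadd.1 Cd hWd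
  -- the twist: `L(E^D,1) ≠ 0` and Kato's Tamagawa-exact `≤`-half
  have hLt' : (W.quadraticTwist (NumberField.discr K : ℚ)).entireLFunction = Wd.entireLFunction := by
    rw [← hWd, entireLFunction_smul]
  have hLd1 : Wd.entireLFunction 1 ≠ 0 := by rw [← hLt']; exact hLt
  have htw := twist_le_half_of_katoTamagawaExact hKatoT hGZK hmod Wd p hp2 haddd hjd hsurjd hLd1
  exact missingLowerBoundAt_of_indexLowerBoundAt_le W p (W.conductorNorm ℤ) K Dt H ι P hGZ hKo hGZK hmod hK
    hHN hP hp2 hc hμ hr hLt Wd Cd hWd hu htam htw hL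

end Summit.BirchSwinnertonDyer.BirchSwinnertonDyer.Theorems.AdditiveBranchIMCGordTwoRankOne.HeegnerKolyvagin

end
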